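import Literature.NumberTheory.LFunctions.KiKimLee
import Literature.NumberTheory.LFunctions.XiHeatRayMonotone
import Literature.NumberTheory.LFunctions.DeBruijnHSimpleZerosProofs
import Literature.NumberTheory.LFunctions.RodgersTaoZeroSet
import Literature.NumberTheory.LFunctions.DeBruijnNewmanUpperBoundProofs
import HarnessLib

/-!
# Ki–Kim–Lee 2009: the far zeros of `H_t` (`t > 0`) are real AND SIMPLE, and `Λ < 1/2` — proofs (discharges of the simplicity clause and, §F, of `Λ < 1/2` via the strict de Bruijn strip)

RH-FREE LITERATURE (label line, cell rh-crit C3), companion PROOFS file of `KiKimLee.lean`. Nothing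
here bears on the truth of RH: every statement is about `H_t` for a FIXED `t > 0`, with a threshold
`4π e^{160/t} + 1` that blows up as `t ↓ 0` (this is NOT a `t`-uniform zero-free region); §F's
`Λ < 1/2` is Ki–Kim–Lee's 2009 bound (RH is `Λ = 0`; the tree also holds the numerics-backed named
fact `Λ ≤ 0.2`), formalised here as literature, not as progress toward RH.

Main result: **`ki_kim_lee_cofinite_simple_holds`** — discharge (CONTENT, neither ex falso nor
dominated) of the named fact `Literature.NumberTheory.LFunctions.ki_kim_lee_cofinite_simple`
(`KiKimLee.lean`: the simplicity clause of Ki–Kim–Lee's theorem "for any `λ > 0`, all but finitely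
many zeros of `H_λ` are real and simple", as printed in Newman–Wu 2020 Thm. 14 p. 9 and Ki 2011
Thm. 3.7 p. 104). With the tree's `ki_kim_lee_finite_holds` (reality clause, `XiHeatRayMonotone.lean`)
this makes the whole printed theorem a tree theorem: `ki_kim_lee_real_simple` (threshold form) and
`finite_setOf_deBruijnH_zero_not_real_simple` (the printed "all but finitely many" wording).

## The argument (not Ki–Kim–Lee's saddle-point proof, whose text is not held — acq-00145 — but a
combination of two mechanisms already in the tree)

* **A. Explicit reality box** (`im_eq_zero_of_deBruijnH_zero_of_exp_le`): for `0 < t < 1/2` every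
  zero of `H_t` with `|Re z| ≥ 4π e^{80/t}` is real — the Hermite–Biehler step of
  `ki_kim_lee_finite_of_strictMonoOn_xiHeatRay` (`DeBruijnHXiHeatRay.lean`) with the threshold of
  `strictMonoOn_norm_xiHeatRay_of_le` (`XiHeatRayMonotone.lean`) kept explicit (the same statement is
  lemma K1 of the Summit-side file `DBNUniformFarZerosReal.lean`, which Literature may not import;
  it is re-derived here verbatim). The threshold decreases in `t`, whence a uniform version on time
  windows (`…_of_le`).
* **B. Located Csordas–Smith–Varga mechanism** (`eventually_exists_nonreal_zero_near`): if `H_{t₀}`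
  has a real zero `x₀` of order `m ≥ 2`, then for all small `σ > 0`, `H_{t₀ − σ²}` has a NON-REAL
  zero within `σR` of `x₀` — the tree's `eventually_exists_nonreal_zero`
  (`DeBruijnHSimpleZerosProofs.lean`: Gaussian smoothing, rescaling to the heat polynomial `P_m`,
  which has a non-real root for `m ≥ 2`, and Hurwitz) with the position of the zero recorded.
* **C. Simplicity** (`deriv_deBruijnH_ne_zero_of_far_real_zero`): for `0 < t ≤ 1/2`, a multiple real
  zero `x₀` of `H_t` with `|x₀| ≥ 4π e^{160/t} + 1` would, by B, produce non-real zeros of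
  `H_{t − σ²}` with `|Re| ≥ 4π e^{160/t} ≥ 4π e^{80/(t − σ²)}` at times `t − σ² ∈ (t/2, 1/2)`, which A
  forces to be real — contradiction. For `t > 1/2` all zeros are real (`Λ ≤ 1/2`, de Bruijn) and
  simple (Csordas–Smith–Varga Thm. 2.2 = `csordasSmithVarga_simple_zeros_holds`, witness `t₁ = 1/2`).
* **D.** The threshold form is turned into the printed cofinite wording using the strip
  `|Im z| < 1` (`Polymath15.abs_im_lt_one_of_zero`) and the finiteness of the zeros of `H_t` in a
  compact set (`finite_deBruijnH_zeros_of_isCompact`).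

## Main results (namespace `Literature.NumberTheory.LFunctions`)

* `im_eq_zero_of_deBruijnH_zero_of_exp_le`, `im_eq_zero_of_deBruijnH_zero_of_exp_le_of_le` (A);
* `eventually_exists_nonreal_zero_near` (B);
* `deriv_deBruijnH_ne_zero_of_far_real_zero`, `im_eq_zero_and_deriv_ne_zero_of_far_zero` — for
  `0 < t ≤ 1/2`, zeros with `|Re z| ≥ 4π e^{160/t} + 1` are real and simple (C, explicit box);
* `ki_kim_lee_cofinite_simple_holds` — **the discharge**; `ki_kim_lee_real_simple` — both clauses,
  hypothesis-free; `finite_setOf_deBruijnH_zero_abs_re_lt`, `finite_setOf_deBruijnH_zero_not_real_simple` (D);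
* (E) bookkeeping around the second fact of `KiKimLee.lean`, `ki_kim_lee_lt_one_half`
  (`Λ < 1/2`): its equivalence with `deBruijnNewmanConst < 1/2` with de Bruijn's and Newman's
  facts fed in (`ki_kim_lee_lt_one_half_iff_lt`), and that it follows from the tree's
  (undischarged, numerics-backed) Platt–Trudgian fact `platt_trudgian` (`Λ ≤ 0.2`,
  `Equivalents.lean`) — `ki_kim_lee_lt_one_half_of_platt_trudgian` (an implication, not a
  discharge).
* (F) **`ki_kim_lee_lt_one_half_holds` — the discharge of `Λ < 1/2`** (CONTENT), following the
  printed architecture (Newman–Wu 2020 p. 9: Thm. 14 + Pólya + the strict-strip lemma Thm. 13):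
  `im_ne_of_deBruijnH_zeros_le_Yfun` (no zero of `H_{t₁}` on a weakly confining parabola
  `Im = √(Y₁² + 2(t₁ − s))` — the zero-sum-variation computation of the tree's proof of Polymath 15
  Prop. 3.3, `DeBruijnNewmanUpperBoundProofs.lean`, which needs neither a barrier nor a minimal
  time once the WEAK bound holds at all nearby times), hence the **strict de Bruijn strip**
  `abs_im_lt_sqrt_of_deBruijnH_zero_of_im_le` / `abs_im_lt_sqrt_of_deBruijnH_zero` (for
  `0 < t < 1/2` every zero of `H_t` has `|Im z| < √(1 − 2t)`, strictly), the uniform form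
  `exists_deBruijnH_zeros_im_le_lt_sqrt` (near zeros finitely many by (D), far zeros real by (A)),
  and de Bruijn's Thm. 13 from `t₀ = 1/4` (`hasOnlyRealZeros_deBruijnH_of_im_le`);
  `deBruijnNewmanConst_lt_one_half` is the hypothesis-free `sInf` form.

## References

* H. Ki, Y.-O. Kim, J. Lee, *On the de Bruijn–Newman constant*, Adv. Math. 222 (2009) 281–306,
  Thm. 1.3 (tree tag; number unverified, primary not held). [KiKimLee2009]
* C. M. Newman, W. Wu, Bull. AMS 57 (2020) 595–614 = arXiv:1901.06596, Thm. 13 and Thm. 14,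
  §2.6 p. 9. [NewmanWu2020]
* N. G. de Bruijn, *The roots of trigonometric integrals*, Duke Math. J. 17 (1950) 197–226,
  Thm. 13. [Bruijn1950]
* H. Ki, *Zeros of zeta functions*, Comment. Math. Univ. St. Pauli 60 (2011) 99–117, Thm. 3.7
  p. 104. [Ki2011]
* G. Csordas, W. Smith, R. S. Varga, Constr. Approx. 10 (1994) 107–129, Thm. 2.2.
  [CsordasSmithVarga1994]
* J. Andrade, A. Chang, S. J. Miller, J. Number Theory 144 (2014) 70–91 = arXiv:1310.3477,
  Remark 1.6 (zeros "pop off" the real line under the backward heat flow). [AndradeChangMiller2014]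
* D. H. J. Polymath, Res. Math. Sci. 6 (2019) 31 = arXiv:1904.12438, §3 (the strip), §4 eq. (30).
  [Polymath2019]
-/

noncomputable section

open Complex Filter Set Topology MeasureTheory Polynomial Metric

namespace Literature.NumberTheory.LFunctions
/-! ## A. Reality of the far zeros with the explicit threshold `4π e^{80/t}` -/

/-- **Explicit reality threshold** (the Hermite–Biehler step of the tree's
`ki_kim_lee_finite_of_strictMonoOn_xiHeatRay` with the threshold of
`strictMonoOn_norm_xiHeatRay_of_le` kept explicit): for `0 < t < 1/2`, every zero `z` of `H_t` with
`|Re z| ≥ 4π e^{80/t}` is real. (The same statement is proved Summit-side as lemma K1 of cell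
rh-crit C3, `DBNUniformFarZerosReal.lean`, which Literature may not import; re-derived here.)
[cite: KiKimLee2009, Thm. 1.3] -/
theorem im_eq_zero_of_deBruijnH_zero_of_exp_le {t : ℝ} (ht0 : 0 < t) (ht : t < 1 / 2) {z : ℂ}
    (hz : deBruijnH t z = 0) (hre : 4 * Real.pi * Real.exp (80 / t) ≤ |z.re|) : z.im = 0 := by
  have key : ∀ w : ℂ, deBruijnH t w = 0 → 4 * Real.pi * Real.exp (80 / t) ≤ w.re → w.im = 0 := by
    intro w hw hwre
    set x : ℝ := w.re with hx
    set y : ℝ := w.im with hy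
    have hy1 : |y| < 1 := Polymath15.abs_im_lt_one_of_zero ht0.le hw
    have hmono := strictMonoOn_norm_xiHeatRay_of_le ht0 ht (T := x / 2) (by linarith)
    set s : ℂ := (1 + I * w) / 2 with hs
    have hs' : s = (((1 - y) / 2 : ℝ) : ℂ) + (x / 2 : ℝ) * I := by
      rw [hs, ← re_add_im w]
      simp only [← hx, ← hy]
      push_cast
      ring_nf
      rw [Complex.I_sq]
      ring
    have h1s : 1 - s = (starRingEnd ℂ) ((((1 + y) / 2 : ℝ) : ℂ) + (x / 2 : ℝ) * I) := by
      rw [hs', map_add, Complex.conj_ofReal, map_mul, Complex.conj_ofReal, Complex.conj_I]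
      push_cast
      ring
    have hrep := deBruijnH_eq_xiHeatRay_add ht0 w
    rw [hw] at hrep
    have hc : ((1 / (8 * Real.sqrt (Real.pi * t)) : ℝ) : ℂ) ≠ 0 := by
      have : 0 < Real.sqrt (Real.pi * t) := Real.sqrt_pos.2 (by positivity)
      exact_mod_cast (by positivity : (1 / (8 * Real.sqrt (Real.pi * t)) : ℝ) ≠ 0)
    have hsum : xiHeatRay t s + xiHeatRay t (1 - s) = 0 := by
      rcases mul_eq_zero.1 hrep.symm with h0 | h0
      · exact absurd h0 hc
      · exact h0
    have hnorm : ‖xiHeatRay t ((((1 - y) / 2 : ℝ) : ℂ) + (x / 2 : ℝ) * I)‖ =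
        ‖xiHeatRay t ((((1 + y) / 2 : ℝ) : ℂ) + (x / 2 : ℝ) * I)‖ := by
      rw [← hs', show xiHeatRay t s = -xiHeatRay t (1 - s) from eq_neg_of_add_eq_zero_left hsum,
        norm_neg, h1s, xiHeatRay_conj, Complex.norm_conj]
    have ha : (1 - y) / 2 ∈ Icc (0 : ℝ) 1 := by
      constructor <;> linarith [(abs_lt.1 hy1).1, (abs_lt.1 hy1).2]
    have hb : (1 + y) / 2 ∈ Icc (0 : ℝ) 1 := by
      constructor <;> linarith [(abs_lt.1 hy1).1, (abs_lt.1 hy1).2]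
    have heq := hmono.injOn ha hb hnorm
    linarith
  rcases le_or_gt 0 z.re with h0 | h0
  · exact key z hz (by rwa [abs_of_nonneg h0] at hre)
  · have hneg : deBruijnH t (-z) = 0 := by rw [deBruijnH_neg, hz]
    have := key (-z) hneg (by rw [neg_re]; rwa [abs_of_neg h0] at hre)
    simpa using this

/-- Uniform version on a time window: if `0 < t₁ ≤ t < 1/2` then every zero of `H_t` with
`|Re z| ≥ 4π e^{80/t₁}` is real (the threshold `4π e^{80/t}` decreases in `t`).
[cite: KiKimLee2009, Thm. 1.3] -/
theorem im_eq_zero_of_deBruijnH_zero_of_exp_le_of_le {t₁ t : ℝ} (ht₁ : 0 < t₁) (h1t : t₁ ≤ t)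
    (ht : t < 1 / 2) {z : ℂ} (hz : deBruijnH t z = 0)
    (hre : 4 * Real.pi * Real.exp (80 / t₁) ≤ |z.re|) : z.im = 0 := by
  refine im_eq_zero_of_deBruijnH_zero_of_exp_le (ht₁.trans_le h1t) ht hz (le_trans ?_ hre)
  gcongr

/-! ## B. Non-real zeros of `H_{t₀ − σ²}` NEAR a multiple real zero of `H_{t₀}` (located form) -/

/-- Local notation (not a declaration), copied from `DeBruijnHSimpleZerosProofs.lean`: the Gaussian
moments `M_j = ∫ e^{−r²/4} r^j dr`. -/
local notation3 "gaussMoment " j:max => ∫ r : ℝ, cexp (-(r : ℂ) ^ 2 / 4) * (r : ℂ) ^ (j : ℕ)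

/-- Local notation (not a declaration), copied from `DeBruijnHSimpleZerosProofs.lean`: the heat
polynomial `P_m`. -/
local notation3 "heatPoly " m:max =>
  ∑ k ∈ Finset.range ((m : ℕ) + 1),
    Polynomial.C (((m : ℕ).choose k : ℂ) * gaussMoment ((m : ℕ) - k)) * Polynomial.X ^ k

/-- Local notation (not a declaration), copied from `DeBruijnHSimpleZerosProofs.lean`: the rescaled
integrand. -/
local notation3 "rescaledIntegrand " g:max m:max p:max r:max =>
  cexp (-(r : ℂ) ^ 2 / 4) *
    (((p : ℝ × ℂ).2 + (r : ℂ)) ^ (m : ℕ) * (g : ℂ → ℂ) ((p : ℝ × ℂ).1 * ((p : ℝ × ℂ).2 + (r : ℂ))))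

section Rescaled

variable {t₀ x₀ : ℝ} {m : ℕ} {g : ℂ → ℂ}

/-- **Located form of the Csordas–Smith–Varga mechanism** (`eventually_exists_nonreal_zero` of
`DeBruijnHSimpleZerosProofs.lean` with the position of the non-real zero recorded): if
`H_{t₀}(x₀ + ζ) = ζ^m g(ζ)` with `m ≥ 2`, `g` continuous, `g(0) ≠ 0`, then there is `R > 0` such
that for all small `σ > 0` the function `H_{t₀ − σ²}` has a NON-REAL zero `z` with
`‖z − x₀‖ ≤ σ R` (namely `z = x₀ + σ w`, `w` near a non-real root `w*` of the heat polynomial `P_m`,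
`R = ‖w*‖ + 1`; Hurwitz's theorem on the rescaled functions). [cite: AndradeChangMiller2014, Remark 1.6] -/
theorem eventually_exists_nonreal_zero_near (hm : 2 ≤ m) (hgc : Continuous g) (hg0 : g 0 ≠ 0)
    (hfac : ∀ ζ : ℂ, deBruijnH t₀ (x₀ + ζ) = ζ ^ m * g ζ) :
    ∃ R : ℝ, 0 < R ∧ ∀ᶠ σ : ℝ in 𝓝[>] 0,
      ∃ z : ℂ, deBruijnH (t₀ - σ ^ 2) z = 0 ∧ z.im ≠ 0 ∧ ‖z - x₀‖ ≤ σ * R := by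
  obtain ⟨wstar, hroot, hwim⟩ := exists_root_heatPoly_im_ne_zero hm
  set Cst : ℂ := ((4 * Real.pi : ℝ) : ℂ) ^ (1 / 2 : ℂ) with hCst
  have hC0 : Cst ≠ 0 := four_pi_cpow_half_ne_zero
  set F : ℝ → ℂ → ℂ := fun σ w ↦ Cst * ((σ : ℂ) ^ m)⁻¹ * deBruijnH (t₀ - σ ^ 2) (x₀ + σ * w)
    with hF
  set f : ℂ → ℂ := fun w ↦ g 0 * (heatPoly m).eval w with hf
  have hFΨ : ∀ σ : ℝ, σ ≠ 0 → ∀ w, F σ w = ∫ r : ℝ, rescaledIntegrand g m (σ, w) r := by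
    intro σ hσ w
    set Int : ℂ := ∫ r : ℝ, rescaledIntegrand g m (σ, w) r with hInt
    simp only [hF]
    rw [deBruijnH_rescaled_eq hfac, ← hInt, ← hCst]
    have : (σ : ℂ) ^ m ≠ 0 := pow_ne_zero _ (Complex.ofReal_ne_zero.2 hσ)
    field_simp
  have hfΨ : ∀ w, f w = ∫ r : ℝ, rescaledIntegrand g m (0, w) r := fun w ↦
    (integral_rescaledIntegrand_zero g m w).symm
  have hp0 : heatPoly m ≠ 0 := by
    intro h
    have := (natDegree_heatPoly m).2
    rw [h, leadingCoeff_zero] at this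
    exact hC0 this.symm
  have him0 : 0 < |wstar.im| := abs_pos.2 hwim
  obtain ⟨ρ, hρ, hρle, hsphere⟩ := exists_sphere_eval_ne_zero hp0 wstar
    (ρmax := min 1 (|wstar.im| / 2)) (lt_min one_pos (by linarith))
  set R : ℝ := ‖wstar‖ + 1 with hR
  have hR0 : 0 < R := by rw [hR]; positivity
  have hsub : closedBall wstar ρ ⊆ closedBall (0 : ℂ) R := by
    intro w hw
    rw [mem_closedBall_zero_iff]
    rw [mem_closedBall, dist_eq_norm] at hw
    calc ‖w‖ = ‖(w - wstar) + wstar‖ := by rw [sub_add_cancel]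
      _ ≤ ‖w - wstar‖ + ‖wstar‖ := norm_add_le _ _
      _ ≤ R := by rw [hR]; linarith [hρle.trans (min_le_left _ _)]
  have hunif : TendstoUniformlyOn F f (𝓝[>] (0 : ℝ)) (closedBall wstar ρ) := by
    rw [Metric.tendstoUniformlyOn_iff]
    intro ε hε
    obtain ⟨δ, hδ, hδε⟩ := rescaled_uniform hgc hfac (R := R) (by positivity) hε
    have h1 : ∀ᶠ σ : ℝ in 𝓝[>] 0, σ ∈ Ioo 0 (min δ 1) := Ioo_mem_nhdsGT (lt_min hδ one_pos)
    filter_upwards [h1] with σ hσ w hw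
    obtain ⟨hσ0, hσ1⟩ := hσ
    rw [hfΨ, hFΨ σ hσ0.ne' w, dist_comm]
    exact hδε σ (by rw [abs_of_pos hσ0]; exact hσ1.trans_le (min_le_left _ _))
      (by rw [abs_of_pos hσ0]; exact (hσ1.trans_le (min_le_right _ _)).le) w (hsub hw)
  have hFd : ∀ᶠ σ : ℝ in 𝓝[>] 0, DiffContOnCl ℂ (F σ) (ball wstar ρ) :=
    Eventually.of_forall fun σ ↦ by
      have : Differentiable ℂ (F σ) := by
        simp only [hF]
        have hd := differentiable_deBruijnH_holds (t₀ - σ ^ 2)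
        exact (hd.comp (by fun_prop)).const_mul _
      exact this.diffContOnCl
  have hfc : ContinuousOn f (sphere wstar ρ) := by
    have : Continuous f := by simp only [hf]; exact continuous_const.mul (Polynomial.continuous _)
    exact this.continuousOn
  have hf0 : f wstar = 0 := by
    simp only [hf]
    exact mul_eq_zero_of_right _ hroot.eq_zero
  have hsph : ∀ z ∈ sphere wstar ρ, f z ≠ 0 := fun z hz ↦ mul_ne_zero hg0 (hsphere z hz)
  have hz := Complex.eventually_exists_zero_mem_ball_of_tendstoUniformlyOn hρ hFd hunif hfc hf0 hsph
  have hpos : ∀ᶠ σ : ℝ in 𝓝[>] 0, 0 < σ := eventually_mem_nhdsWithin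
  refine ⟨R, hR0, ?_⟩
  filter_upwards [hz, hpos] with σ ⟨w, hw, hFw⟩ hσ
  refine ⟨x₀ + σ * w, ?_, ?_, ?_⟩
  · simp only [hF] at hFw
    have h1 : Cst * ((σ : ℂ) ^ m)⁻¹ ≠ 0 :=
      mul_ne_zero hC0 (inv_ne_zero (pow_ne_zero _ (Complex.ofReal_ne_zero.2 hσ.ne')))
    exact (mul_eq_zero.1 hFw).resolve_left h1
  · have hwim' : w.im ≠ 0 := by
      intro h0
      rw [mem_ball, dist_eq_norm] at hw
      have h2 : |(w - wstar).im| ≤ ‖w - wstar‖ := abs_im_le_norm _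
      rw [Complex.sub_im, h0, zero_sub, abs_neg] at h2
      have hρ' : ρ ≤ |wstar.im| / 2 := hρle.trans (min_le_right _ _)
      linarith
    rw [Complex.add_im, Complex.ofReal_im, zero_add, Complex.mul_im, Complex.ofReal_re,
      Complex.ofReal_im, zero_mul, add_zero]
    exact mul_ne_zero hσ.ne' hwim'
  · have hwR : ‖w‖ ≤ R := mem_closedBall_zero_iff.1 (hsub (ball_subset_closedBall hw))
    rw [add_sub_cancel_left, norm_mul, Complex.norm_real, Real.norm_eq_abs, abs_of_pos hσ]
    exact mul_le_mul_of_nonneg_left hwR hσ.le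

end Rescaled

/-! ## C. Simplicity of the far zeros (`0 < t ≤ 1/2`) and the discharge -/

/-- **Far real zeros of `H_t` are simple, explicit box** (`0 < t ≤ 1/2`): a real zero `x₀` of `H_t`
with `|x₀| ≥ 4π e^{160/t} + 1` has `H_t'(x₀) ≠ 0`. Proof (Csordas–Smith–Varga mechanism + the
explicit Ki–Kim–Lee box): a multiple real zero at time `t` spawns NON-REAL zeros of `H_{t − σ²}`
within distance `σR` of `x₀` for all small `σ > 0` (`eventually_exists_nonreal_zero_near`); for
`σ² < t/2` and `σR ≤ 1` such a zero has `|Re| ≥ 4π e^{160/t} ≥ 4π e^{80/(t − σ²)}` and time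
`t − σ² ∈ (t/2, 1/2)`, so it is REAL by `im_eq_zero_of_deBruijnH_zero_of_exp_le` — contradiction.
[cite: KiKimLee2009, Thm. 1.3] [cite: NewmanWu2020, Thm. 14 p. 9] -/
theorem deriv_deBruijnH_ne_zero_of_far_real_zero {t : ℝ} (ht0 : 0 < t) (ht : t ≤ 1 / 2) {x₀ : ℝ}
    (hx₀ : deBruijnH t x₀ = 0) (hfar : 4 * Real.pi * Real.exp (160 / t) + 1 ≤ |x₀|) :
    deriv (deBruijnH t) x₀ ≠ 0 := by
  intro hderiv
  obtain ⟨m, g, hm, hgc, hg0, hfac⟩ := exists_factor_of_multiple_zero t hx₀ hderiv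
  obtain ⟨R, hR0, hev⟩ := eventually_exists_nonreal_zero_near hm hgc hg0 hfac
  -- σ small: σ² < t/2 and σR ≤ 1
  have hsmall : ∀ᶠ σ : ℝ in 𝓝[>] 0, σ ^ 2 < t / 2 ∧ σ * R ≤ 1 := by
    have h1 : ∀ᶠ σ : ℝ in 𝓝 (0 : ℝ), σ ^ 2 < t / 2 := by
      have hc : ContinuousAt (fun σ : ℝ ↦ σ ^ 2) 0 := by fun_prop
      exact hc.eventually_lt continuousAt_const (by simpa using half_pos ht0)
    have h2 : ∀ᶠ σ : ℝ in 𝓝 (0 : ℝ), σ * R ≤ 1 := by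
      have hc : ContinuousAt (fun σ : ℝ ↦ σ * R) 0 := by fun_prop
      exact (hc.eventually_lt continuousAt_const (by simp)).mono fun σ h ↦ h.le
    exact (h1.and h2).filter_mono nhdsWithin_le_nhds
  have hpos : ∀ᶠ σ : ℝ in 𝓝[>] 0, 0 < σ := eventually_mem_nhdsWithin
  obtain ⟨σ, ⟨⟨z, hz, hzim, hzx⟩, hσ2, hσR⟩, hσ⟩ := ((hev.and hsmall).and hpos).exists
  -- the new zero is far out and its time is in (t/2, 1/2)
  set t' : ℝ := t - σ ^ 2 with ht'
  have ht'0 : t / 2 < t' := by rw [ht']; linarith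
  have ht'1 : t' < 1 / 2 := by
    rw [ht']; nlinarith [sq_nonneg σ, hσ]
  have hre : 4 * Real.pi * Real.exp (160 / t) ≤ |z.re| := by
    have h1 : |x₀| - 1 ≤ |z.re| := by
      have h2 : |z.re - x₀| ≤ ‖z - x₀‖ := by
        simpa [Complex.sub_re, Complex.ofReal_re] using abs_re_le_norm (z - x₀)
      have h3 : |x₀| - |z.re| ≤ |z.re - x₀| := by
        rw [abs_sub_comm]; exact abs_sub_abs_le_abs_sub x₀ z.re
      linarith
    linarith
  have hthr : 4 * Real.pi * Real.exp (80 / t') ≤ 4 * Real.pi * Real.exp (160 / t) := by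
    have h : 80 / t' ≤ 160 / t := by
      rw [div_le_div_iff₀ (by linarith) ht0]; nlinarith
    have := Real.exp_le_exp.2 h
    nlinarith [Real.pi_pos, Real.exp_pos (80 / t')]
  have him : z.im = 0 :=
    im_eq_zero_of_deBruijnH_zero_of_exp_le (by linarith) ht'1 hz (hthr.trans hre)
  exact hzim him

/-- **Ki–Kim–Lee, explicit box** (`0 < t ≤ 1/2`): every zero `z` of `H_t` with
`|Re z| ≥ 4π e^{160/t} + 1` is real and simple. [cite: KiKimLee2009, Thm. 1.3]
[cite: NewmanWu2020, Thm. 14 p. 9] [cite: Ki2011, Thm. 3.7 p. 104] -/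
theorem im_eq_zero_and_deriv_ne_zero_of_far_zero {t : ℝ} (ht0 : 0 < t) (ht : t ≤ 1 / 2) {z : ℂ}
    (hz : deBruijnH t z = 0) (hfar : 4 * Real.pi * Real.exp (160 / t) + 1 ≤ |z.re|) :
    z.im = 0 ∧ deriv (deBruijnH t) z ≠ 0 := by
  have him : z.im = 0 := by
    rcases ht.lt_or_eq with ht' | ht'
    · refine im_eq_zero_of_deBruijnH_zero_of_exp_le ht0 ht' hz (le_trans ?_ hfar)
      have : Real.exp (80 / t) ≤ Real.exp (160 / t) := by
        apply Real.exp_le_exp.2; rw [div_le_div_iff₀ ht0 ht0]; nlinarith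
      nlinarith [Real.pi_pos, Real.exp_pos (160 / t)]
    · have hreal : HasOnlyRealZeros (deBruijnH t) := by
        rw [ht']; exact hasOnlyRealZeros_deBruijnH_one_half_holds
      exact hreal z hz
  have hzre : ((z.re : ℝ) : ℂ) = z := by
    apply Complex.ext <;> simp [him]
  refine ⟨him, ?_⟩
  have h := deriv_deBruijnH_ne_zero_of_far_real_zero ht0 ht (x₀ := z.re) (by rw [hzre]; exact hz)
    (by simpa using hfar)
  rwa [hzre] at h

/-- **Discharge of `ki_kim_lee_cofinite_simple` — CONTENT** (not ex falso, not dominated): for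
`0 < t ≤ 1/2` the threshold `T = 4π e^{160/t} + 1` works
(`im_eq_zero_and_deriv_ne_zero_of_far_zero`); for `t > 1/2` every zero is real (`Λ ≤ 1/2`,
`hasOnlyRealZeros_deBruijnH_one_half_holds` + de Bruijn monotonicity) and simple
(Csordas–Smith–Varga, `csordasSmithVarga_simple_zeros_holds` with the witness `t₁ = 1/2`), so
`T = 0` works. [cite: KiKimLee2009, Thm. 1.3] [cite: NewmanWu2020, Thm. 14 p. 9]
[cite: Ki2011, Thm. 3.7 p. 104] -/
theorem ki_kim_lee_cofinite_simple_holds : ki_kim_lee_cofinite_simple := by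
  intro t ht0
  rcases le_or_gt t (1 / 2) with ht | ht
  · exact ⟨4 * Real.pi * Real.exp (160 / t) + 1, fun z hz hfar ↦
      (im_eq_zero_and_deriv_ne_zero_of_far_zero ht0 ht hz hfar).2⟩
  · refine ⟨0, fun z hz _ ↦ ?_⟩
    have hhalf := hasOnlyRealZeros_deBruijnH_one_half_holds
    have hreal : HasOnlyRealZeros (deBruijnH t) := mono_deBruijnH_holds ht.le hhalf
    have him : z.im = 0 := hreal z hz
    have hzre : ((z.re : ℝ) : ℂ) = z := by
      apply Complex.ext <;> simp [him]
    have h := csordasSmithVarga_simple_zeros_holds (1 / 2) t ht hhalf z.re (by rw [hzre]; exact hz)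
    rwa [hzre] at h

/-- **Ki–Kim–Lee's finiteness theorem, both clauses, unconditional in the tree** (threshold form):
for every `t > 0` there is `T` such that every zero of `H_t` with `|Re z| ≥ T` is real and simple
(Newman–Wu 2020 Thm. 14; Ki 2011 Thm. 3.7). From `ki_kim_lee_finite_holds` (reality,
`XiHeatRayMonotone.lean`) and `ki_kim_lee_cofinite_simple_holds`. [cite: NewmanWu2020, Thm. 14 p. 9]
[cite: Ki2011, Thm. 3.7 p. 104] [cite: KiKimLee2009, Thm. 1.3] -/
theorem ki_kim_lee_real_simple {t : ℝ} (ht : 0 < t) :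
    ∃ T : ℝ, ∀ z : ℂ, deBruijnH t z = 0 → T ≤ |z.re| → z.im = 0 ∧ deriv (deBruijnH t) z ≠ 0 :=
  ki_kim_lee_real_simple_of ki_kim_lee_finite_holds ki_kim_lee_cofinite_simple_holds ht

/-! ## D. The printed "all but finitely many" wording -/

/-- The zeros of `H_t` (`t ≥ 0`) with `|Re z| < T` form a finite set: they lie in the compact box
`|Re z| ≤ T`, `|Im z| ≤ 1` (`Polymath15.abs_im_lt_one_of_zero`) and the zeros of the entire
function `H_t ≢ 0` in a compact set are finite (`finite_deBruijnH_zeros_of_isCompact`).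
[cite: NewmanWu2020, Thm. 14 p. 9] -/
theorem finite_setOf_deBruijnH_zero_abs_re_lt {t : ℝ} (ht : 0 ≤ t) (T : ℝ) :
    {z : ℂ | deBruijnH t z = 0 ∧ |z.re| < T}.Finite := by
  have hK : IsCompact {z : ℂ | |z.re| ≤ T ∧ |z.im| ≤ 1} := by
    refine Metric.isCompact_of_isClosed_isBounded ?_ ?_
    · exact (isClosed_le (continuous_abs.comp Complex.continuous_re) continuous_const).inter
        (isClosed_le (continuous_abs.comp Complex.continuous_im) continuous_const)
    · refine (Metric.isBounded_closedBall (x := (0 : ℂ)) (r := |T| + 1)).subset fun z hz ↦ ?_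
      rw [mem_closedBall_zero_iff]
      calc ‖z‖ ≤ |z.re| + |z.im| := Complex.norm_le_abs_re_add_abs_im z
        _ ≤ |T| + 1 := by linarith [hz.1, hz.2, le_abs_self T]
  refine (finite_deBruijnH_zeros_of_isCompact t hK).subset fun z hz ↦ ⟨⟨hz.2.le, ?_⟩, hz.1⟩
  exact (Polymath15.abs_im_lt_one_of_zero ht hz.1).le

/-- **"For any `λ > 0`, all but finitely many zeros of `H_λ` are real and simple"** — the printed
wording (Newman–Wu 2020 Thm. 14 p. 9; Ki 2011 Thm. 3.7 p. 104; Ki–Kim–Lee 2009), for the tree's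
`H_t`, `t > 0`: the set of zeros that are not both real and simple is finite.
[cite: NewmanWu2020, Thm. 14 p. 9] [cite: Ki2011, Thm. 3.7 p. 104] [cite: KiKimLee2009, Thm. 1.3] -/
theorem finite_setOf_deBruijnH_zero_not_real_simple {t : ℝ} (ht : 0 < t) :
    {z : ℂ | deBruijnH t z = 0 ∧ ¬(z.im = 0 ∧ deriv (deBruijnH t) z ≠ 0)}.Finite := by
  obtain ⟨T, hT⟩ := ki_kim_lee_real_simple ht
  refine (finite_setOf_deBruijnH_zero_abs_re_lt ht.le T).subset fun z hz ↦ ⟨hz.1, ?_⟩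
  by_contra hlt
  exact hz.2 (hT z hz.1 (not_lt.1 hlt))

/-! ## E. `Λ < 1/2`: bookkeeping around the fact `ki_kim_lee_lt_one_half` (discharged in §F) -/

/-- `ki_kim_lee_lt_one_half ↔ Λ < 1/2`, with de Bruijn's nonemptiness
(`hasOnlyRealZeros_deBruijnH_one_half_holds`) and Newman's lower bound
(`bddBelow_setOf_hasOnlyRealZeros_holds`) fed in (cf. `ki_kim_lee_lt_one_half_iff`).
[cite: Ki2011, Thm. 3.8 p. 104] -/
theorem ki_kim_lee_lt_one_half_iff_lt : ki_kim_lee_lt_one_half ↔ deBruijnNewmanConst < 1 / 2 :=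
  ki_kim_lee_lt_one_half_iff hasOnlyRealZeros_deBruijnH_one_half_holds
    bddBelow_setOf_hasOnlyRealZeros_holds

/-- The KKL bound `Λ < 1/2` (fact `ki_kim_lee_lt_one_half`) is implied by the tree's Platt–Trudgian
fact `platt_trudgian` (`H_t` real-rooted for every `t > 1/5`, i.e. `Λ ≤ 0.2`; Platt–Trudgian 2021
Cor. 2 via Polymath 15 — itself an undischarged, numerics-backed named fact owned by the pub-dbn
cell): take `t = 3/10`. Recorded so that the fact ledger sees the implication; it does NOT
discharge `ki_kim_lee_lt_one_half`. [cite: Ki2011, Thm. 3.8 p. 104] -/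
theorem ki_kim_lee_lt_one_half_of_platt_trudgian (h : platt_trudgian) : ki_kim_lee_lt_one_half :=
  ⟨3 / 10, by norm_num, h _ (by norm_num)⟩

/-! ## F. The strict de Bruijn strip (Ki–Kim–Lee's lemma, Newman–Wu 2020 Thm. 13, for `H_t`) and
the discharge of `ki_kim_lee_lt_one_half` (`Λ < 1/2`) -/

section StrictStrip

open Polymath15 Literature.Analysis.Complex

/-- A zero `ρ` of `H_t` has a companion zero `σ` in the closed first quadrant with `Re σ = |Re ρ|`,
`Im σ = |Im ρ|` (the zero set is invariant under `z ↦ z̄` and `z ↦ −z̄`).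
[cite: Polymath2019, §3] -/
theorem exists_deBruijnH_zero_abs_re_abs_im {t : ℝ} {ρ : ℂ} (hρ : deBruijnH t ρ = 0) :
    ∃ σ : ℂ, deBruijnH t σ = 0 ∧ σ.im = |ρ.im| ∧ σ.re = |ρ.re| := by
  rcases le_or_gt 0 ρ.im with h1 | h1 <;> rcases le_or_gt 0 ρ.re with h2 | h2
  · exact ⟨ρ, hρ, (abs_of_nonneg h1).symm, (abs_of_nonneg h2).symm⟩
  · exact ⟨-(starRingEnd ℂ ρ), zero_neg_conj hρ, by simp [abs_of_nonneg h1],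
      by simp [abs_of_neg h2]⟩
  · exact ⟨starRingEnd ℂ ρ, deBruijnH_conj_eq_zero hρ, by simp [abs_of_neg h1],
      by simp [abs_of_nonneg h2]⟩
  · exact ⟨-ρ, by rw [deBruijnH_neg]; exact hρ, by simp [abs_of_neg h1],
      by simp [abs_of_neg h2]⟩

/-- `∂_t H_t'(w) = (∂_t H_t)'(w)` (both equal `−S_3(t, w)`); restated here because the copy in
`DeBruijnNewmanUpperBoundProofs.lean` is private. [folklore] -/
private theorem strictStrip_hf't (t : ℝ) (w : ℂ) :
    HasDerivAt (fun s ↦ deriv (deBruijnH s) w) (deriv (cosMoment 2 t) w) t := by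
  rw [(hasDerivAt_cosMoment_two_z t w).deriv]
  exact hasDerivAt_deriv_deBruijnH_time t w

/-- Joint continuity of `(t, w) ↦ (∂_t H_t)'(w) = −S_3(t, w)`. [folklore] -/
private theorem strictStrip_hfd'c : Continuous fun p : ℝ × ℂ ↦ deriv (cosMoment 2 p.1) p.2 := by
  have : (fun p : ℝ × ℂ ↦ deriv (cosMoment 2 p.1) p.2) = fun p ↦ -sinMoment 3 p.1 p.2 :=
    funext fun p ↦ (hasDerivAt_cosMoment_two_z p.1 p.2).deriv
  rw [this]
  exact (continuous_sinMoment_uncurry 3).neg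

/-- **No zero on a weakly confining parabola** (the mechanism of Ki–Kim–Lee's strict-strip lemma,
Newman–Wu 2020 Thm. 13, run on the tree's proof of Polymath 15, Prop. 3.3). Let `Y₁ > 0` and
suppose that for all times `s ≤ t₁` close to `t₁` every zero of `H_s` has imaginary part
`≤ Y(s) := √(Y₁² + 2(t₁ − s))` (a WEAK bound, e.g. de Bruijn's Thm. 13), and that the zeros of
`H_{t₁}` lie in `|Im| < 1`. Then no zero `z₁` of `H_{t₁}` with `Re z₁ > 0` lies ON the parabola,
`Im z₁ = Y₁`. Proof: exactly the computation of `Polymath15.no_minimal_bad` without barrier and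
without a minimal time — at such a `z₁` (multiplicity `m`, local cofactor `Q`) the weighted sum
`c(s)` of the zeros of `H_s` in a small rectangle around `z₁` has `Im c(s) ≤ m Y(s)` for `s < t₁`
(the weak bound) and `Im c(t₁) = m Y₁`, so its left difference quotients at `t₁` are `≥ 0`, while
`Im ċ(t₁) = 2m Im (Q'/Q)(z₁) < −m²/Y₁ ≤ m Ẏ(t₁)` (`im_logDeriv_cofactor_lt`: the conjugate zero
gives `−m/(2Y₁)`, the reflected zero `−z₁` strictly less, every other zero `≤ 0` because it lies
weakly below `Y₁`). [cite: NewmanWu2020, Thm. 13 p. 9] [cite: Polymath2019, Prop. 3.3 (proof)] -/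
theorem im_ne_of_deBruijnH_zeros_le_Yfun {t₁ Y₁ : ℝ} (hY₁ : 0 < Y₁)
    (hbelow : ∀ᶠ s in 𝓝[≤] t₁, ∀ ρ : ℂ, deBruijnH s ρ = 0 → ρ.im ≤ Yfun t₁ Y₁ s)
    (hstrip : ∀ ρ : ℂ, deBruijnH t₁ ρ = 0 → |ρ.im| < 1)
    {z₁ : ℂ} (hz₁ : deBruijnH t₁ z₁ = 0) (hx₁ : 0 < z₁.re) : z₁.im ≠ Y₁ := by
  intro hz_im
  have hzY : 0 < z₁.im := by rw [hz_im]; exact hY₁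
  have hz_im' : z₁.im = Yfun t₁ Y₁ t₁ := by rw [hz_im, Yfun_self hY₁.le]
  -- the weak bound at time `t₁` itself: every zero has `|Im| ≤ Y₁`
  have hnow : ∀ ρ : ℂ, deBruijnH t₁ ρ = 0 → ρ.im ≤ Y₁ := by
    have h := hbelow.self_of_nhdsWithin (mem_Iic.2 le_rfl)
    intro ρ hρ
    have := h ρ hρ
    rwa [Yfun_self hY₁.le] at this
  have habs : ∀ ρ : ℂ, deBruijnH t₁ ρ = 0 → |ρ.im| ≤ z₁.im := by
    intro ρ hρ
    rw [hz_im]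
    have h1 := hnow ρ hρ
    have h2 := hnow _ (deBruijnH_conj_eq_zero hρ)
    rw [Complex.conj_im] at h2
    exact abs_le.2 ⟨by linarith, h1⟩
  ----------------------------------------------------------------
  -- (a) Hadamard data at `z₁` and the sign computation (the "far" hypothesis is vacuous)
  ----------------------------------------------------------------
  obtain ⟨bseq, hb⟩ := exists_isHadamardSeq t₁
  set m : ℕ := hb.mult z₁ with hm_def
  have hm : 0 < m := hb.mult_pos hz₁
  set Q : ℂ → ℂ := hb.cofactor z₁ with hQ_def
  have hfacQ : ∀ w, deBruijnH t₁ w = (w - z₁) ^ m * Q w := hb.eq_pow_mul_cofactor hz₁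
  have hQd : Differentiable ℂ Q := hb.differentiable_cofactor z₁
  have hQ0 : Q z₁ ≠ 0 := hb.cofactor_self_ne_zero hz₁
  have hL : (logDeriv Q z₁).im < -m / (2 * z₁.im) :=
    im_logDeriv_cofactor_lt hx₁ hzY hz₁ hstrip
      (fun ρ hρ h ↦ absurd (habs ρ hρ) (not_le.2 h)) (hQd.analyticAt z₁) hQ0
      (Eventually.of_forall hfacQ)
  ----------------------------------------------------------------
  -- (b) an isolating rectangle `K = [a,b] × [c,d]` around `z₁` inside `{Re > 0, Im > 0}`
  ----------------------------------------------------------------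
  have hiso : ∀ᶠ w in 𝓝[≠] z₁, deBruijnH t₁ w ≠ 0 := by
    rcases ((differentiable_deBruijnH_holds t₁).analyticAt
      z₁).eventually_eq_zero_or_eventually_ne_zero with h | h
    · exfalso
      obtain ⟨w₀, hw₀⟩ := exists_deBruijnH_ne_zero t₁
      have hall := ((differentiable_deBruijnH_holds t₁).differentiableOn.analyticOnNhd
        isOpen_univ).eqOn_zero_of_preconnected_of_eventuallyEq_zero isPreconnected_univ
        (mem_univ z₁) h
      exact hw₀ (hall (mem_univ w₀))
    · exact h
  obtain ⟨r₀, hr₀, hiso'⟩ : ∃ r₀ > 0, ∀ w, dist w z₁ < r₀ → w ≠ z₁ → deBruijnH t₁ w ≠ 0 := by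
    rw [eventually_nhdsWithin_iff, Metric.eventually_nhds_iff] at hiso
    obtain ⟨r₀, hr₀, h⟩ := hiso
    exact ⟨r₀, hr₀, fun w hw hne ↦ h hw hne⟩
  set r : ℝ := min z₁.re (min z₁.im r₀) / 4 with hr
  have hr_pos : 0 < r := by
    have : 0 < min z₁.re (min z₁.im r₀) := lt_min hx₁ (lt_min hzY hr₀)
    rw [hr]; linarith
  have hr1 : 4 * r ≤ z₁.re := by
    rw [hr]; linarith [min_le_left z₁.re (min z₁.im r₀)]
  have hr3 : 4 * r ≤ z₁.im := by
    rw [hr]; linarith [min_le_right z₁.re (min z₁.im r₀), min_le_left z₁.im r₀]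
  have hr4 : 4 * r ≤ r₀ := by
    rw [hr]; linarith [min_le_right z₁.re (min z₁.im r₀), min_le_right z₁.im r₀]
  set a : ℝ := z₁.re - r with ha_def
  set b : ℝ := z₁.re + r with hb_def
  set c : ℝ := z₁.im - r with hc_def
  set d : ℝ := z₁.im + r with hd_def
  have hab : a < b := by rw [ha_def, hb_def]; linarith
  have hcd : c < d := by rw [hc_def, hd_def]; linarith
  have ha : a < z₁.re := by rw [ha_def]; linarith
  have hb' : z₁.re < b := by rw [hb_def]; linarith
  have hc : c < z₁.im := by rw [hc_def]; linarith
  have hd' : z₁.im < d := by rw [hd_def]; linarith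
  -- points of the closed rectangle are within `r₀` of `z₁`
  have hKdist : ∀ w ∈ Icc a b ×ℂ Icc c d, dist w z₁ < r₀ := by
    intro w hw
    obtain ⟨⟨hwa, hwb⟩, ⟨hwc, hwd⟩⟩ := hw
    rw [dist_eq_norm]
    have hre : |(w - z₁).re| ≤ r := by
      rw [sub_re, abs_le]; constructor <;> [rw [ha_def] at hwa; rw [hb_def] at hwb] <;> linarith
    have him : |(w - z₁).im| ≤ r := by
      rw [sub_im, abs_le]; constructor <;> [rw [hc_def] at hwc; rw [hd_def] at hwd] <;> linarith
    have := norm_le_abs_re_add_abs_im (w - z₁)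
    linarith
  have hKzero : ∀ w ∈ Icc a b ×ℂ Icc c d, deBruijnH t₁ w = 0 → w = z₁ := fun w hw h0 ↦ by
    by_contra hne; exact hiso' w (hKdist w hw) hne h0
  have hQK : ∀ w ∈ Icc a b ×ℂ Icc c d, Q w ≠ 0 := by
    intro w hw hQw
    have h0 : deBruijnH t₁ w = 0 := by rw [hfacQ, hQw, mul_zero]
    have := hKzero w hw h0
    rw [this] at hQw
    exact hQ0 hQw
  have hbdK : rectBoundarySet a b c d ⊆ Icc a b ×ℂ Icc c d :=
    rectBoundarySet_subset_reProdIm hab.le hcd.le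
  have hbdz : ∀ w ∈ rectBoundarySet a b c d, w ≠ z₁ := fun w hw ↦
    ne_of_mem_rectBoundarySet ha hb' hc hd' hw
  have h0bd : ∀ w ∈ rectBoundarySet a b c d, deBruijnH t₁ w ≠ 0 := fun w hw h0 ↦
    hbdz w hw (hKzero w (hbdK hw) h0)
  ----------------------------------------------------------------
  -- (c) the variation formula and local constancy of the count
  ----------------------------------------------------------------
  have hfd : ∀ t, Differentiable ℂ (cosMoment 2 t) := fun t w ↦
    (hasDerivAt_cosMoment_z 2 t w).differentiableAt
  obtain ⟨δ, hδ, hnear⟩ := exists_rectBoundaryIntegral_logDeriv_eq_nhds (f := deBruijnH)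
    (fd := fun t w ↦ cosMoment 2 t w) (t₁ := t₁) hab.le hcd.le hasDerivAt_deBruijnH_time
    strictStrip_hf't continuous_deBruijnH_uncurry continuous_deriv_deBruijnH_uncurry
    (continuous_cosMoment_uncurry 2) strictStrip_hfd'c differentiable_deBruijnH_holds hfd h0bd
  have hvar := hasDerivAt_rectBoundaryIntegral_logDeriv_mul (f := deBruijnH)
    (fd := fun t w ↦ cosMoment 2 t w) (g := fun w : ℂ ↦ w) (t₁ := t₁) hab.le hcd.le
    hasDerivAt_deBruijnH_time strictStrip_hf't continuous_deBruijnH_uncurry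
    continuous_deriv_deBruijnH_uncurry (continuous_cosMoment_uncurry 2) strictStrip_hfd'c
    (differentiable_deBruijnH_holds t₁) (hfd t₁) differentiable_id h0bd
  -- the value of the derivative: `(1/2πi)∮ H''/H = 2m Q'/Q(z₁)`
  have hD : -rectBoundaryIntegral
      (fun w ↦ cosMoment 2 t₁ w / deBruijnH t₁ w * deriv (fun w : ℂ ↦ w) w) a b c d =
      2 * Real.pi * I * (2 * m * logDeriv Q z₁) := by
    have e : (fun w ↦ cosMoment 2 t₁ w / deBruijnH t₁ w * deriv (fun w : ℂ ↦ w) w) =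
        fun w ↦ (-1) * (deriv (deriv (deBruijnH t₁)) w / deBruijnH t₁ w) := by
      funext w
      rw [deriv_id'', mul_one, deriv_deriv_deBruijnH]
      ring
    rw [e, rectBoundaryIntegral_const_mul, neg_mul, one_mul, neg_neg]
    exact rectBoundaryIntegral_deriv_deriv_div hQd hfacQ ha hb' hc hd' hQK
  rw [hD] at hvar
  ----------------------------------------------------------------
  -- (d) the weighted zero sums
  ----------------------------------------------------------------
  choose nord hnord hμ using fun t ρ ↦ exists_nat_order t ρ
  set Z : ℝ → Set ℂ := fun t ↦ {ρ : ℂ | deBruijnH t ρ = 0 ∧ ρ ∈ Ioo a b ×ℂ Ioo c d} with hZ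
  have hcorner : ((a : ℂ) + c * I) ∈ Icc a b ×ℂ Icc c d :=
    ⟨by simpa using hab.le, by simpa using hcd.le⟩
  have hcorner_bd : ((a : ℂ) + c * I) ∈ rectBoundarySet a b c d :=
    Or.inl (Or.inl ⟨a, left_mem_Icc.2 hab.le, rfl⟩)
  have hZfin : ∀ t, |t - t₁| ≤ δ → (Z t).Finite := fun t ht ↦
    finite_zeros_reProdIm hab.le hcd.le
      ((differentiable_deBruijnH_holds t).differentiableOn.analyticOnNhd isOpen_univ |>.mono
        (subset_univ _)) hcorner ((hnear t ht).1 _ hcorner_bd)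
  have hWAP : ∀ t, |t - t₁| ≤ δ → ∀ g : ℂ → ℂ, Differentiable ℂ g →
      rectBoundaryIntegral (fun w ↦ deriv (deBruijnH t) w / deBruijnH t w * g w) a b c d =
        2 * Real.pi * I * ∑ᶠ ρ ∈ Z t, (nord t ρ : ℂ) * g ρ := by
    intro t ht g hg
    rw [rectBoundaryIntegral_logDeriv_mul_eq_finsum hab hcd
      ((differentiable_deBruijnH_holds t).differentiableOn.analyticOnNhd isOpen_univ |>.mono
        (subset_univ _)) (hg.differentiableOn.analyticOnNhd isOpen_univ |>.mono (subset_univ _))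
      (hnear t ht).1]
    congr 1
    exact finsum_mem_congr rfl fun ρ _ ↦ by rw [hμ]
  -- at `t₁`: the only zero in `K` is `z₁`, of multiplicity `m`
  have hZ₁ : Z t₁ = {z₁} := by
    ext ρ
    simp only [hZ, mem_setOf_eq, mem_singleton_iff]
    constructor
    · rintro ⟨h0, hρ⟩
      exact hKzero ρ ⟨Ioo_subset_Icc_self hρ.1, Ioo_subset_Icc_self hρ.2⟩ h0
    · rintro rfl
      exact ⟨hz₁, ⟨by simpa using And.intro ha hb', by simpa using And.intro hc hd'⟩⟩
  have hn₁ : nord t₁ z₁ = m := by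
    have h1 := hnord t₁ z₁
    rw [hb.analyticOrderAt_eq_mult hz₁] at h1
    exact_mod_cast h1.symm
  have ht₁δ : |t₁ - t₁| ≤ δ := by simp [hδ.le]
  have hcount : ∀ t, |t - t₁| ≤ δ → ∑ᶠ ρ ∈ Z t, (nord t ρ : ℂ) = m := by
    intro t ht
    have h1 := hWAP t ht (fun _ ↦ 1) (differentiable_const _)
    have h2 := hWAP t₁ ht₁δ (fun _ ↦ 1) (differentiable_const _)
    simp only [mul_one] at h1 h2
    rw [(hnear t ht).2] at h1
    rw [h1, hZ₁, finsum_mem_singleton, hn₁] at h2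
    have hπ : (2 * Real.pi * I : ℂ) ≠ 0 := by simp [Real.pi_ne_zero, I_ne_zero]
    exact mul_left_cancel₀ hπ h2
  set csum : ℝ → ℂ := fun t ↦ ∑ᶠ ρ ∈ Z t, (nord t ρ : ℂ) * ρ with hcsum
  have hcsum₁ : csum t₁ = m * z₁ := by
    simp only [hcsum, hZ₁, finsum_mem_singleton, hn₁]
  have hcsum_eq : ∀ t, |t - t₁| ≤ δ → csum t = (2 * Real.pi * I)⁻¹ *
      rectBoundaryIntegral (fun w ↦ deriv (deBruijnH t) w / deBruijnH t w * w) a b c d := by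
    intro t ht
    rw [hWAP t ht (fun w ↦ w) differentiable_id, ← mul_assoc, inv_mul_cancel₀, one_mul]
    simp [Real.pi_ne_zero, I_ne_zero]
  have hcsum_deriv :
      HasDerivAt csum ((2 * Real.pi * I)⁻¹ * (2 * Real.pi * I * (2 * m * logDeriv Q z₁))) t₁ := by
    have hev : csum =ᶠ[𝓝 t₁] fun t ↦ (2 * Real.pi * I)⁻¹ *
        rectBoundaryIntegral (fun w ↦ deriv (deBruijnH t) w / deBruijnH t w * w) a b c d := by
      filter_upwards [Metric.closedBall_mem_nhds t₁ hδ] with t ht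
      exact hcsum_eq t (by rwa [Metric.mem_closedBall, Real.dist_eq] at ht)
    exact (hvar.const_mul _).congr_of_eventuallyEq hev
  have hcsum_deriv' : HasDerivAt csum (2 * m * logDeriv Q z₁) t₁ := by
    have hπ : (2 * Real.pi * I : ℂ) ≠ 0 := by simp [Real.pi_ne_zero, I_ne_zero]
    have := hcsum_deriv
    rwa [← mul_assoc, inv_mul_cancel₀ hπ, one_mul] at this
  ----------------------------------------------------------------
  -- (e) near `t₁` the zeros in `K` lie weakly below `Im = Y(t)` (the weak bound)
  ----------------------------------------------------------------
  have hweak : ∀ t, (∀ ρ : ℂ, deBruijnH t ρ = 0 → ρ.im ≤ Yfun t₁ Y₁ t) → |t - t₁| ≤ δ →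
      (csum t).im ≤ m * Yfun t₁ Y₁ t := by
    intro t hbt ht
    have hfin := hZfin t ht
    have hsumeq : csum t = ∑ ρ ∈ hfin.toFinset, (nord t ρ : ℂ) * ρ :=
      finsum_mem_eq_finite_toFinset_sum _ hfin
    have hcnt : ∑ ρ ∈ hfin.toFinset, (nord t ρ : ℂ) = m := by
      rw [← finsum_mem_eq_finite_toFinset_sum _ hfin]; exact hcount t ht
    have hcnt' : ∑ ρ ∈ hfin.toFinset, nord t ρ = m := by exact_mod_cast hcnt
    have hle : ∀ ρ ∈ hfin.toFinset, ρ.im ≤ Yfun t₁ Y₁ t := by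
      intro ρ hρ
      rw [Set.Finite.mem_toFinset] at hρ
      exact hbt ρ hρ.1
    have him_sum : (csum t).im = ∑ ρ ∈ hfin.toFinset, (nord t ρ : ℝ) * ρ.im := by
      rw [hsumeq, Complex.im_sum]
      refine Finset.sum_congr rfl fun ρ _ ↦ ?_
      simp
    rw [him_sum]
    calc ∑ ρ ∈ hfin.toFinset, (nord t ρ : ℝ) * ρ.im
        ≤ ∑ ρ ∈ hfin.toFinset, (nord t ρ : ℝ) * Yfun t₁ Y₁ t :=
          Finset.sum_le_sum fun ρ hρ ↦ mul_le_mul_of_nonneg_left (hle ρ hρ) (Nat.cast_nonneg _)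
      _ = m * Yfun t₁ Y₁ t := by
          rw [← Finset.sum_mul]
          congr 1
          exact_mod_cast hcnt'
  ----------------------------------------------------------------
  -- (f) `g(t) = Im c(t) − m Y(t)`: `g(t₁) = 0`, `g ≤ 0` just left of `t₁`, but `g'(t₁) < 0`
  ----------------------------------------------------------------
  set gfun : ℝ → ℝ := fun t ↦ (csum t).im - m * Yfun t₁ Y₁ t with hg_def
  have hg₁ : gfun t₁ = 0 := by
    show (csum t₁).im - m * Yfun t₁ Y₁ t₁ = 0
    rw [hcsum₁, ← hz_im']
    simp
  have hgderiv : HasDerivAt gfun ((2 * m * logDeriv Q z₁).im - m * (-1 / Yfun t₁ Y₁ t₁)) t₁ := by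
    have h1 : HasDerivAt (fun t ↦ (csum t).im) ((2 * m * logDeriv Q z₁).im) t₁ :=
      Complex.imCLM.hasFDerivAt.comp_hasDerivAt t₁ hcsum_deriv'
    have h2 : HasDerivAt (fun t ↦ (m : ℝ) * Yfun t₁ Y₁ t) (m * (-1 / Yfun t₁ Y₁ t₁)) t₁ :=
      (hasDerivAt_Yfun hY₁ le_rfl).const_mul (m : ℝ)
    exact h1.sub h2
  have hgneg : (2 * m * logDeriv Q z₁).im - m * (-1 / Yfun t₁ Y₁ t₁) < 0 := by
    have e : (2 * (m : ℂ) * logDeriv Q z₁).im = 2 * m * (logDeriv Q z₁).im := by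
      simp [Complex.mul_im]
    rw [e, ← hz_im']
    have hm1 : (1 : ℝ) ≤ m := by exact_mod_cast hm
    have h1 : 2 * (m : ℝ) * (logDeriv Q z₁).im < 2 * m * (-(m : ℝ) / (2 * z₁.im)) :=
      mul_lt_mul_of_pos_left hL (by positivity)
    have h2 : 2 * (m : ℝ) * (-(m : ℝ) / (2 * z₁.im)) = -(m * (m / z₁.im)) := by ring
    have h3 : (m : ℝ) / z₁.im ≤ m * (m / z₁.im) :=
      le_mul_of_one_le_left (div_nonneg (Nat.cast_nonneg _) hzY.le) hm1
    have h4 : (m : ℝ) * (-1 / z₁.im) = -(m / z₁.im) := by ring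
    rw [h4]
    linarith
  -- slopes from the left are eventually negative ...
  have hslope : ∀ᶠ t in 𝓝[<] t₁, slope gfun t₁ t < 0 := by
    have h := (hasDerivAt_iff_tendsto_slope.1 hgderiv).eventually_mem (Iio_mem_nhds hgneg)
    exact h.filter_mono (nhdsWithin_mono _ fun t ht ↦ ne_of_lt ht)
  -- ... but `g(t) ≤ 0 = g(t₁)` for `t < t₁` close to `t₁` makes them non-negative
  have hev₁ : ∀ᶠ t in 𝓝[<] t₁, ∀ ρ : ℂ, deBruijnH t ρ = 0 → ρ.im ≤ Yfun t₁ Y₁ t :=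
    hbelow.filter_mono (nhdsWithin_mono t₁ Iio_subset_Iic_self)
  have hev₂ : ∀ᶠ t in 𝓝[<] t₁, t < t₁ := self_mem_nhdsWithin
  have hev₃ : ∀ᶠ t in 𝓝[<] t₁, |t - t₁| ≤ δ := by
    have : ∀ᶠ t in 𝓝 t₁, |t - t₁| ≤ δ := by
      filter_upwards [Metric.closedBall_mem_nhds t₁ hδ] with t ht
      rwa [Metric.mem_closedBall, Real.dist_eq] at ht
    exact eventually_nhdsWithin_of_eventually_nhds this
  obtain ⟨t, hst, hbt, htt, htδ⟩ := (hslope.and (hev₁.and (hev₂.and hev₃))).exists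
  have hgt : gfun t ≤ 0 := by
    have := hweak t hbt htδ
    simp only [hg_def]
    linarith
  rw [slope_def_field, hg₁, sub_zero] at hst
  have : 0 ≤ gfun t / (t - t₁) := div_nonneg_of_nonpos hgt (by linarith)
  linarith

/-- **The strict de Bruijn strip for `H_t`** (Ki–Kim–Lee 2009; Newman–Wu 2020, Thm. 13: under
de Bruijn's hypothesis "zeros in `|Im z| ≤ Δ₀`" the zeros at time `λ ∈ (0, Δ₀²/2)` lie in
`|Im z| ≤ Δ₁` for some `Δ₁ < √(Δ₀² − 2λ)` — "the equality in (strip) cannot be reached"), in the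
tree's normalisation and pointwise form: if `t₀ ≥ 0`, `y₀ > 0` and every zero of `H_{t₀}` has
`Im ≤ y₀`, then for `t > t₀` with `2(t − t₀) < y₀²` every zero of `H_t` has
`|Im z| < √(y₀² − 2(t − t₀))` STRICTLY (de Bruijn's Thm. 13, `de_bruijn_strip_shrinking_holds`,
gives `≤`). From `im_ne_of_deBruijnH_zeros_le_Yfun` fed with the weak bound at all times in
`(t₀, t]`. (The uniform `Δ₁` of the printed statement follows for `H_t` from the finiteness of the
non-real zeros, `exists_deBruijnH_zeros_im_le_lt_sqrt`.)
[cite: NewmanWu2020, Thm. 13 p. 9] [cite: KiKimLee2009, strict-strip lemma (theorem number unverified, primary not held acq-00145)]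
[cite: Bruijn1950, Thm. 13] -/
theorem abs_im_lt_sqrt_of_deBruijnH_zero_of_im_le {t₀ y₀ : ℝ} (ht₀ : 0 ≤ t₀) (hy₀ : 0 < y₀)
    (hup : ∀ z : ℂ, deBruijnH t₀ z = 0 → z.im ≤ y₀) {t : ℝ} (ht : t₀ < t)
    (h2t : 2 * (t - t₀) < y₀ ^ 2) {z : ℂ} (hz : deBruijnH t z = 0) :
    |z.im| < Real.sqrt (y₀ ^ 2 - 2 * (t - t₀)) := by
  -- the weak bound at every time `s ∈ (t₀, t]`, written with `Yfun t Y₁`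
  set Y₁ : ℝ := Real.sqrt (y₀ ^ 2 - 2 * (t - t₀)) with hY₁_def
  have hY₁pos : 0 < Y₁ := Real.sqrt_pos.2 (by linarith)
  have hY₁sq : Y₁ ^ 2 = y₀ ^ 2 - 2 * (t - t₀) := Real.sq_sqrt (by linarith)
  have hweak : ∀ s, t₀ < s → s ≤ t → ∀ ρ : ℂ, deBruijnH s ρ = 0 → |ρ.im| ≤ Yfun t Y₁ s := by
    intro s hs hst ρ hρ
    have hYs : Yfun t Y₁ s = Real.sqrt (max (y₀ ^ 2 - 2 * (s - t₀)) 0) := by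
      rw [Yfun, hY₁sq, max_eq_left (by linarith)]
      ring_nf
    have h1 := de_bruijn_strip_shrinking_holds t₀ y₀ hy₀ hup s hs ρ hρ
    have h2 := de_bruijn_strip_shrinking_holds t₀ y₀ hy₀ hup s hs _ (deBruijnH_conj_eq_zero hρ)
    rw [Complex.conj_im] at h2
    rw [hYs]
    exact abs_le.2 ⟨by linarith, h1⟩
  have hle : |z.im| ≤ Y₁ := by
    have := hweak t ht le_rfl z hz
    rwa [Yfun_self hY₁pos.le] at this
  refine lt_of_le_of_ne hle fun heq ↦ ?_
  -- a zero in the open first quadrant on the parabola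
  obtain ⟨σ, hσ, hσim, hσre⟩ := exists_deBruijnH_zero_abs_re_abs_im hz
  have hσre_pos : 0 < σ.re := by rw [hσre]; exact abs_pos.2 (re_ne_zero_of_zero hz)
  refine im_ne_of_deBruijnH_zeros_le_Yfun hY₁pos ?_ (fun ρ hρ ↦ abs_im_lt_one_of_zero
    (ht₀.trans ht.le) hρ) hσ hσre_pos (hσim.trans heq)
  -- the weak bound on a left-neighbourhood of `t` within `(-∞, t]`
  have hmem : Ioc t₀ t ∈ 𝓝[≤] t := Ioc_mem_nhdsLE ht
  filter_upwards [hmem] with s hs ρ hρ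
  exact (le_abs_self _).trans (hweak s hs.1 hs.2 ρ hρ)

/-- The strict strip from time `0` (`Δ₀ = 1`, the critical strip): for `0 < t < 1/2` every zero of
`H_t` has `|Im z| < √(1 − 2t)` — strict form of `Polymath15.abs_im_le_sqrt_of_zero`.
[cite: NewmanWu2020, Thm. 13 p. 9] [cite: KiKimLee2009, strict-strip lemma (theorem number unverified, primary not held acq-00145)] -/
theorem abs_im_lt_sqrt_of_deBruijnH_zero {t : ℝ} (ht : 0 < t) (ht' : t < 1 / 2) {z : ℂ}
    (hz : deBruijnH t z = 0) : |z.im| < Real.sqrt (1 - 2 * t) := by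
  have hup : ∀ w : ℂ, deBruijnH 0 w = 0 → w.im ≤ 1 := fun w hw ↦
    (abs_lt.1 (abs_im_lt_one_of_zero le_rfl hw)).2.le
  have h := abs_im_lt_sqrt_of_deBruijnH_zero_of_im_le le_rfl one_pos hup ht (by linarith) hz
  simpa using h

/-- **Newman–Wu Thm. 13's conclusion for `f = H_0`, uniformly** (this is where Ki–Kim–Lee's
finiteness theorem enters, as in the printed proof of `Λ < 1/2`, Newman–Wu p. 9): for
`0 < t < 1/2` there is `y₀` with `0 < y₀ < √(1 − 2t)` such that every zero of `H_t` has
`Im z ≤ y₀`. The zeros with `|Re z| ≥ 4π e^{80/t}` are real (`im_eq_zero_of_deBruijnH_zero_of_exp_le`,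
the reality clause of KKL's Thm. 1.3 with the tree's explicit box); the others are finitely many
(`finite_setOf_deBruijnH_zero_abs_re_lt`) and each lies strictly inside the strip
(`abs_im_lt_sqrt_of_deBruijnH_zero`). [cite: NewmanWu2020, Thm. 13 and Thm. 14, p. 9]
[cite: KiKimLee2009, strict-strip lemma (theorem number unverified, primary not held acq-00145)] -/
theorem exists_deBruijnH_zeros_im_le_lt_sqrt {t : ℝ} (ht : 0 < t) (ht' : t < 1 / 2) :
    ∃ y₀ : ℝ, 0 < y₀ ∧ y₀ < Real.sqrt (1 - 2 * t) ∧ ∀ z : ℂ, deBruijnH t z = 0 → z.im ≤ y₀ := by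
  set T : ℝ := 4 * Real.pi * Real.exp (80 / t) with hT
  set S : Set ℂ := {z : ℂ | deBruijnH t z = 0 ∧ |z.re| < T} with hS
  have hSfin : S.Finite := finite_setOf_deBruijnH_zero_abs_re_lt ht.le T
  set s₀ : ℝ := Real.sqrt (1 - 2 * t) with hs₀
  have hs₀pos : 0 < s₀ := Real.sqrt_pos.2 (by linarith)
  -- candidate bounds: the imaginary parts of the near zeros, and `s₀/2`
  set A : Set ℝ := (fun z : ℂ ↦ z.im) '' S ∪ {s₀ / 2} with hA
  have hAfin : A.Finite := (hSfin.image _).union (Set.finite_singleton _)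
  have hAne : A.Nonempty := ⟨s₀ / 2, Or.inr rfl⟩
  obtain ⟨y₀, hy₀A, hy₀max⟩ := Set.exists_max_image A id hAfin hAne
  have hAlt : ∀ y ∈ A, y < s₀ := by
    rintro y (⟨z, hz, rfl⟩ | rfl)
    · exact (le_abs_self _).trans_lt (abs_im_lt_sqrt_of_deBruijnH_zero ht ht' hz.1)
    · linarith
  refine ⟨y₀, ?_, hAlt y₀ hy₀A, fun z hz ↦ ?_⟩
  · have := hy₀max (s₀ / 2) (Or.inr rfl)
    simp only [id] at this
    linarith
  · rcases lt_or_ge |z.re| T with hlt | hge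
    · have := hy₀max z.im (Or.inl ⟨z, ⟨hz, hlt⟩, rfl⟩)
      simpa using this
    · have h0 : z.im = 0 := im_eq_zero_of_deBruijnH_zero_of_exp_le ht ht' hz hge
      have := hy₀max (s₀ / 2) (Or.inr rfl)
      simp only [id] at this
      rw [h0]
      linarith

/-- **Discharge of `Literature.NumberTheory.LFunctions.ki_kim_lee_lt_one_half` — Ki–Kim–Lee 2009:
`Λ < 1/2`** (CONTENT: a real proof, neither ex falso nor dominated; Ki 2011 Thm. 3.8 p. 104;
Newman–Wu 2020 p. 9: "Combining this [Thm. 14 + Pólya] with Theorem 13, one concludes the upper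
bound `Λ_{DN} < 1/2`"). Following the printed architecture: at `t = 1/4` every zero of `H_{1/4}`
has `Im ≤ y₀` for some `0 < y₀ < √(1/2)` (`exists_deBruijnH_zeros_im_le_lt_sqrt` = strict strip +
KKL finiteness), so de Bruijn's Thm. 13 from `t₀ = 1/4` (`hasOnlyRealZeros_deBruijnH_of_im_le`)
makes `H_{1/4 + y₀²/2}` real-rooted, and `1/4 + y₀²/2 < 1/2`.
[cite: Ki2011, Thm. 3.8 p. 104] [cite: NewmanWu2020, §2.6 p. 9 (Thm. 13, Thm. 14)]
[cite: KiKimLee2009, Thm. 1.1 (number unverified, primary not held acq-00145)] -/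
theorem ki_kim_lee_lt_one_half_holds : ki_kim_lee_lt_one_half := by
  obtain ⟨y₀, hy₀, hy₀lt, hup⟩ :=
    exists_deBruijnH_zeros_im_le_lt_sqrt (t := 1 / 4) (by norm_num) (by norm_num)
  refine ⟨1 / 4 + y₀ ^ 2 / 2, ?_, hasOnlyRealZeros_deBruijnH_of_im_le hy₀ hup le_rfl⟩
  have hsq : Real.sqrt (1 - 2 * (1 / 4 : ℝ)) ^ 2 = 1 - 2 * (1 / 4 : ℝ) :=
    Real.sq_sqrt (by norm_num)
  have h2 : y₀ ^ 2 < Real.sqrt (1 - 2 * (1 / 4 : ℝ)) ^ 2 :=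
    pow_lt_pow_left₀ hy₀lt hy₀.le two_ne_zero
  rw [hsq] at h2
  linarith

/-- `Λ < 1/2` hypothesis-free, in the tree's `sInf` form. [cite: Ki2011, Thm. 3.8 p. 104] -/
theorem deBruijnNewmanConst_lt_one_half : deBruijnNewmanConst < 1 / 2 :=
  ki_kim_lee_lt_one_half_iff_lt.1 ki_kim_lee_lt_one_half_holds

end StrictStrip

end Literature.NumberTheory.LFunctions

end
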